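import Summits.KontsevichZagierPeriods.KontsevichZagierPeriods.Theorems.TerasomaMultiplicationBetaCancellationSwapSubstitutionAE
import Summits.KontsevichZagierPeriods.KontsevichZagierPeriods.Theorems.TerasomaMultiplicationBetaCancellationScaledJacobian
import Summits.KontsevichZagierPeriods.KontsevichZagierPeriods.Theorems.TerasomaMultiplicationBetaCancellationStubCatalystAlgebraicPoint
import Summits.KontsevichZagierPeriods.KontsevichZagierPeriods.Theorems.BetaCancellation.Negative.Torsion

/-!
# `BetaCancellation` (stmt-KontsevichZagierPeriods-13633), line `dirichlet-companion-to-pi` — stub `stub_swapSubstitution` (seat c15): SWAP SUBSTITUTIONS DESCEND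

**The maximally tilting one-move certificate descends.** Let `p = [K, k]` be a catalyst of non-zero
value and `q = p ⊗ r`, `q' = p ⊗ r'` pinned products (catalyst first) whose bases
`r = [σ, f]`, `r' = [σ', f']` have the dimension `d` of the catalyst. If ONE change of variables
`Φ : q → q'` (the data of `KZ.changeOfVariablesRel`) is of SWAP FORM — `head (Φ (x, w)) = α w`,
`tail (Φ (x, w)) = β x` with `α`, `β` `ℚ`-semialgebraic on `σ` resp. `K`, injective there, with
derivatives within — then `r ∼ r'` (`stub_swapSubstitution`). The crux notes (c11 H5, c12 I1, c14 K4)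
single out substitutions whose base part depends on the catalyst coordinate as the open one-move core,
the two descended one-move classes so far being "catalyst coordinate preserved" (fibred) and "base
part catalyst-independent" (fibre form, seat c14); a swap is the opposite extreme — the base part
depends ONLY on the catalyst coordinate — and it descends too, by ARITHMETIC:

* the measure core (`stub_swapSubstitutionAE`, module `…SwapSubstitutionAE`): `α σ = K`, `β K = σ'`,
  `r'.value = r.value =: v`, and the scaled a.e. identities `v · (k ∘ α)|det α'| = p.value · f` on `σ`,
  `p.value · (f' ∘ β)|det β'| = v · k` on `K`;
* if `v = 0`: `f = 0` a.e., and `(f' ∘ β)|det β'| = 0` a.e. makes `f' = 0` a.e. on `β K = σ'`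
  (`volume_image_sep_ne_zero_eq_zero`); both representations are relations;
* if `v ≠ 0`: the scale `C = v / p.value` of the identity on `K` is ALGEBRAIC
  (`isAlgebraic_of_ae_scaledJacobian`, module `…ScaledJacobian`: the catalyst is not null), so
  `C · p ∼ r'` along `β` and `C⁻¹ · r ∼ p` along `α` (`equivalent_of_ae_jacobian`), whence
  `r = C · (C⁻¹ · r) ∼ C · p ∼ r'` (`KZ.Equivalent.constMul`, `constMul_constMul_inv`).

Note the soundness check: `eval r = v = C · π` for the disc — the base of a swap certificate is itself
a catalyst up to an algebraic factor (e.g. `[(0,1), 4/(1+w²)] ⊗`-exchanged with the arcsine kernel by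
`w ↦ 4w²/(1+w²)²`), and no counterexample hides here. No definitions; sorry-free;
axioms ⊆ {propext, Classical.choice, Quot.sound}.

References: M. Kontsevich, D. Zagier, *Periods* (2001), §1.2 rule (2); J. Bochnak, M. Coste,
M.-F. Roy, *Real Algebraic Geometry* (1998), §2.8.
-/

noncomputable section

-- `Summit.KontsevichZagierPeriods.KontsevichZagierPeriods.…` is the tree's mandated layout (single-conjunct summit).
set_option linter.dupNamespace false

namespace Summit.KontsevichZagierPeriods.KontsevichZagierPeriods.BetaCancellationLine

open MeasureTheory Set
open Literature.NumberTheory.Transcendental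
open Literature.NumberTheory.Transcendental.KZ
open Summit.KontsevichZagierPeriods.KontsevichZagierPeriods.BetaCancellationNegative
  (constMul_constMul_inv)

/-- STUB (seat c15). **Swap substitutions descend.** Let `p` be a catalyst of non-zero value and
`q = p ⊗ r`, `q' = p ⊗ r'` pinned products whose bases have the dimension of the catalyst. If ONE
change of variables `Φ : q → q'` is of swap form — `head ∘ Φ = α ∘ tail`, `tail ∘ Φ = β ∘ head` with
`α`, `β` `ℚ`-semialgebraic on `r.domain` resp. `p.domain`, injective there, differentiable within —
then `r ∼ r'`: the scale `r.value / p.value` of the scaled a.e. Jacobian identities of the measure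
core is algebraic (or the bases are null), and `r ∼ (r.value/p.value) · p ∼ r'`.
[cite: KontsevichZagier2001, §1.2 rule (2)] -/
theorem stub_swapSubstitution {d : ℕ} (p : IntegralRep d) (hp : p.value ≠ 0)
    (r r' : IntegralRep d) (q q' : IntegralRep (d + d))
    (hq : q.domain = {z | (fun i => z (Fin.castAdd d i)) ∈ p.domain ∧
      (fun j => z (Fin.natAdd d j)) ∈ r.domain})
    (hqi : Set.EqOn q.integrand (fun z => p.integrand (fun i => z (Fin.castAdd d i)) *
      r.integrand (fun j => z (Fin.natAdd d j))) q.domain)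
    (hq' : q'.domain = {z | (fun i => z (Fin.castAdd d i)) ∈ p.domain ∧
      (fun j => z (Fin.natAdd d j)) ∈ r'.domain})
    (hq'i : Set.EqOn q'.integrand (fun z => p.integrand (fun i => z (Fin.castAdd d i)) *
      r'.integrand (fun j => z (Fin.natAdd d j))) q'.domain)
    (Φ : (Fin (d + d) → ℝ) → (Fin (d + d) → ℝ))
    (Φ' : (Fin (d + d) → ℝ) → (Fin (d + d) → ℝ) →L[ℝ] (Fin (d + d) → ℝ))
    (hΦ' : ∀ z ∈ q.domain, HasFDerivWithinAt Φ (Φ' z) q.domain z) (hΦinj : Set.InjOn Φ q.domain)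
    (himg : q'.domain = Φ '' q.domain)
    (hjac : ∀ z ∈ q.domain, q.integrand z = q'.integrand (Φ z) * |(Φ' z).det|)
    (α β : (Fin d → ℝ) → (Fin d → ℝ)) (α' β' : (Fin d → ℝ) → (Fin d → ℝ) →L[ℝ] (Fin d → ℝ))
    (hαsa : IsSemialgebraicMapOn ℚ r.domain α) (hβsa : IsSemialgebraicMapOn ℚ p.domain β)
    (hhead : ∀ z ∈ q.domain, (fun i => Φ z (Fin.castAdd d i)) = α (fun j => z (Fin.natAdd d j)))
    (htail : ∀ z ∈ q.domain, (fun j => Φ z (Fin.natAdd d j)) = β (fun i => z (Fin.castAdd d i)))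
    (hα' : ∀ w ∈ r.domain, HasFDerivWithinAt α (α' w) r.domain w)
    (hβ' : ∀ x ∈ p.domain, HasFDerivWithinAt β (β' x) p.domain x)
    (hαinj : Set.InjOn α r.domain) (hβinj : Set.InjOn β p.domain) :
    Equivalent r r' := by
  have hσm : MeasurableSet r.domain := IntegralRep.measurableSet_domain_holds r
  have hKm : MeasurableSet p.domain := IntegralRep.measurableSet_domain_holds p
  have hmemq : ∀ z, z ∈ q.domain ↔ (fun i => z (Fin.castAdd d i)) ∈ p.domain ∧
      (fun j => z (Fin.natAdd d j)) ∈ r.domain := fun z => by rw [hq]; rfl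
  have hmemq' : ∀ z, z ∈ q'.domain ↔ (fun i => z (Fin.castAdd d i)) ∈ p.domain ∧
      (fun j => z (Fin.natAdd d j)) ∈ r'.domain := fun z => by rw [hq']; rfl
  rcases r.domain.eq_empty_or_nonempty with hσ | hσ
  · -- (0) empty base: `σ' = ∅` as well, and both representations are relations
    have hKne : p.domain.Nonempty := by
      by_contra h
      apply hp
      rw [not_nonempty_iff_eq_empty] at h
      simp [IntegralRep.value, h]
    obtain ⟨x₀, hx₀⟩ := hKne
    have hσ' : r'.domain = ∅ := by
      rw [eq_empty_iff_forall_notMem]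
      intro w' hw'
      have hz' : Fin.append x₀ w' ∈ q'.domain := by
        rw [hmemq']
        simp only [Fin.append_left, Fin.append_right]
        exact ⟨hx₀, hw'⟩
      rw [himg] at hz'
      obtain ⟨z, hz, -⟩ := hz'
      have hzσ := ((hmemq z).1 hz).2
      rw [hσ] at hzσ
      exact hzσ
    have h₁ : of r ∈ relations := of_mem_relations_of_volume_eq_zero r (by rw [hσ, measure_empty])
    have h₂ : of r' ∈ relations := of_mem_relations_of_volume_eq_zero r' (by rw [hσ', measure_empty])
    exact relations.sub_mem h₁ h₂
  -- (1) the measure core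
  obtain ⟨hαK, hβσ', hv, haeα, haeβ⟩ := stub_swapSubstitutionAE p hp r r' hσ q q' hq hqi hq' hq'i
    Φ Φ' hΦ' hΦinj himg hjac α β α' β' hhead htail hα' hβ' hαinj hβinj
  have hmapsα : MapsTo α r.domain p.domain := fun w hw => hαK ▸ mem_image_of_mem α hw
  have hmapsβ : MapsTo β p.domain r'.domain := fun x hx => hβσ' ▸ mem_image_of_mem β hx
  by_cases hv0 : r.value = 0
  · -- (2) degenerate case: `f = 0` a.e. on `σ`, `f' = 0` a.e. on `σ' = β K`
    have hf0 : ∀ᵐ w ∂(volume.restrict r.domain), r.integrand w = 0 := by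
      filter_upwards [haeα] with w hw
      rw [hv0, zero_mul] at hw
      rcases mul_eq_zero.1 hw.symm with h | h
      · exact absurd h hp
      · exact h
    have h₁ : of r ∈ relations := by
      apply of_mem_relations_of_volume_sep_ne_zero_eq_zero r
      rw [ae_restrict_iff' hσm, ae_iff] at hf0
      convert hf0 using 2
      ext w
      simp only [mem_setOf_eq, Classical.not_imp]
    have hzero : ∀ᵐ x ∂(volume.restrict p.domain), r'.integrand (β x) * |(β' x).det| = 0 := by
      filter_upwards [haeβ] with x hx
      rw [hv0, zero_mul] at hx
      rcases mul_eq_zero.1 hx with h | h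
      · exact absurd h hp
      · exact h
    have h₂ : of r' ∈ relations := by
      apply of_mem_relations_of_volume_sep_ne_zero_eq_zero r'
      have hcover : {w' | w' ∈ r'.domain ∧ r'.integrand w' ≠ 0} ⊆
          β '' {x | x ∈ p.domain ∧ r'.integrand (β x) ≠ 0} := by
        intro w' hw'
        have hw'β : w' ∈ β '' p.domain := hβσ'.symm ▸ hw'.1
        obtain ⟨x, hx, rfl⟩ := hw'β
        exact ⟨x, ⟨hx, hw'.2⟩, rfl⟩
      exact measure_mono_null hcover
        (volume_image_sep_ne_zero_eq_zero p r' β β' hβsa hmapsβ hβ' hzero)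
    exact relations.sub_mem h₁ h₂
  · -- (3) non-degenerate case: the scale `C = r.value / p.value` is algebraic
    set C : ℝ := r.value / p.value with hC_def
    have hC0 : C ≠ 0 := div_ne_zero hv0 hp
    have haeβ' : ∀ᵐ x ∂(volume.restrict p.domain),
        C * p.integrand x = r'.integrand (β x) * |(β' x).det| := by
      filter_upwards [haeβ] with x hx
      rw [hC_def, div_mul_eq_mul_div, div_eq_iff hp]
      linarith [hx]
    have hpK : volume {x | x ∈ p.domain ∧ p.integrand x ≠ 0} ≠ 0 := fun h =>
      hp (catalyst_value_eq_zero_of_volume_sep_ne_zero p h)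
    have hC : IsAlgebraic ℚ C :=
      isAlgebraic_of_ae_scaledJacobian p r' C β β' hβsa hmapsβ hβ' haeβ' hpK
    -- descent along `β`: `C · p ∼ r'`
    have hd₁ : Equivalent (p.constMul C hC) r' := by
      refine equivalent_of_ae_jacobian (p.constMul C hC) r' β β' hβsa hβ' hβinj hβσ'.symm ?_
      simpa [IntegralRep.integrand_constMul] using haeβ'
    -- descent along `α`: `C⁻¹ · r ∼ p`
    have haeα' : ∀ᵐ w ∂(volume.restrict r.domain),
        C⁻¹ * r.integrand w = p.integrand (α w) * |(α' w).det| := by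
      filter_upwards [haeα] with w hw
      rw [hC_def, inv_div, div_mul_eq_mul_div, div_eq_iff hv0]
      linarith [hw]
    have hd₂ : Equivalent (r.constMul C⁻¹ hC.inv) p := by
      refine equivalent_of_ae_jacobian (r.constMul C⁻¹ hC.inv) p α α' hαsa hα' hαinj hαK.symm ?_
      simpa [IntegralRep.integrand_constMul] using haeα'
    -- assemble: `r = C · (C⁻¹ · r) ∼ C · p ∼ r'`
    have hd₃ : Equivalent r (p.constMul C hC) := by
      have h := hd₂.constMul C hC
      rwa [constMul_constMul_inv r hC hC0] at h
    have heq : of r - of r' = (of r - of (p.constMul C hC)) + (of (p.constMul C hC) - of r') := by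
      abel
    change of r - of r' ∈ relations
    rw [heq]
    exact relations.add_mem hd₃ hd₁

end Summit.KontsevichZagierPeriods.KontsevichZagierPeriods.BetaCancellationLine

end
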